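import Summits.ResolutionOfSingularities.ResolutionOfSingularities.Theorems.KeyChainLU2
import HarnessLib

/-!
# KeyChainLU3 — decomp-res node «KeyLadder» (lens-1 g21), tree file 3/5: key-chain local uniformization

Content VERBATIM from the decomp-res lens-1 g21 tree companion `HOME/decomp-res-lens-1/g21/tree/KeyChainLU.lean`
(sha 0edd4007, 1 331 l; = the node
`g21/KeyLadder.lean` a1145436 re-namespaced, typed against the LANDED `Theorems.WCut`, nothing inlined; farm rc 0 ·
0 err · 0 warn · 0 sorry, axioms
standard; HOME = run/shared/lean/pub/decomp-res).  Critic: CRITIC-LEDGER row 163 (DECIDED +1 · MAP 0: the kernel law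
`relLU_of_keyChainTop`, cell
`KeyChainTopBelow`, exact cuts of both `W`-halves; 2026-08-31T01:02:09Z); landing orders INBOX :625 / :633,
`g21/WRITER.md` 82b559ef.  Landed by
decomp-res writer g9 for the lens-1 column (host route `Valuative`, item `LuAlphaPTorsor` stmt-…-0641 — HELPER
files, no route edit) as
`KeyChainLU` / `KeyChainLU2` / … (PARTS I–VI, greedy ≤ 400-line packing, linear imports) and `KeyChainCut` (PART
VII, the split point named in
WRITER.md); namespace, sections, section variables / opens and every declaration exactly as in the companion (its
one global linter option dropped;
the companion lemma `valuation_algebraMap_eq_one` restated the landed `Literature…ELU.valuation_algebraMap_eq_one` —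
gate `dedup.landed` p800231 —
so the copy is dropped and its two uses cite the Literature lemma, import `EmbeddedLocalUniformization` in file 2).

-/

noncomputable section

open IsLocalRing Literature.AlgebraicGeometry.Resolution
open Summit.ResolutionOfSingularities.ResolutionOfSingularities.Theorems

namespace Summit.ResolutionOfSingularities.ResolutionOfSingularities.Theorems.KeyChainLU

section Model

variable {k : Type} [Field k] {K : Type} [Field K] [Algebra k K] {O : ValuationSubring K}
variable {g : ℕ → K} {e : ℕ → ℕ} {b : ℕ → ℕ →₀ ℤ} {ζ : ℕ → k}

/-- `model_fg`: Auxiliary step of the key-chain calculus, VERBATIM from the lens-1 g21 companion (see the module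
docstring); the statement is its type. [folklore] -/
theorem model_fg (n : ℕ) {r : ℕ} (Y' : Fin r → K) : (model k g e b n Y').FG :=
  ⟨(Set.finite_range (gen g e b n Y')).toFinset, by rw [Set.Finite.coe_toFinset]; rfl⟩

/-- `Y_mem_model`: Auxiliary step of the key-chain calculus, VERBATIM from the lens-1 g21 companion (see the module
docstring); the statement is its type. [folklore] -/
theorem Y_mem_model {n r : ℕ} {Y' : Fin r → K} (t : Fin r) : Y' t ∈ model k g e b n Y' :=
  Algebra.subset_adjoin ⟨Sum.inl t, rfl⟩

/-- `Zee_mem_model`: Auxiliary step of the key-chain calculus, VERBATIM from the lens-1 g21 companion (see the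
module docstring); the statement is its type. [folklore] -/
theorem Zee_mem_model {n r : ℕ} {Y' : Fin r → K} (l : Fin n) : Zee g e b l ∈ model k g e b n Y' :=
  Algebra.subset_adjoin ⟨Sum.inr (Sum.inl l), rfl⟩

/-- `Zee_inv_mem_model`: Auxiliary step of the key-chain calculus, VERBATIM from the lens-1 g21 companion (see the
module docstring); the statement is its type. [folklore] -/
theorem Zee_inv_mem_model {n r : ℕ} {Y' : Fin r → K} (l : Fin n) :
    (Zee g e b l)⁻¹ ∈ model k g e b n Y' :=
  Algebra.subset_adjoin ⟨Sum.inr (Sum.inr l), rfl⟩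

/-- `Zee_zpow_mem_model`: Auxiliary step of the key-chain calculus, VERBATIM from the lens-1 g21 companion (see the
module docstring); the statement is its type. [folklore] -/
theorem Zee_zpow_mem_model {n r : ℕ} {Y' : Fin r → K} {l : ℕ} (hl : l < n) (m : ℤ) :
    Zee g e b l ^ m ∈ model k g e b n Y' := by
  rcases Int.eq_nat_or_neg m with ⟨m', rfl | rfl⟩
  · rw [zpow_natCast]
    exact Subalgebra.pow_mem _ (Zee_mem_model ⟨l, hl⟩) m'
  · rw [zpow_neg, zpow_natCast, ← inv_pow]
    exact Subalgebra.pow_mem _ (Zee_inv_mem_model ⟨l, hl⟩) m'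

/-- `mon_Zee_mem_model`: Auxiliary step of the key-chain calculus, VERBATIM from the lens-1 g21 companion (see the
module docstring); the statement is its type. [folklore] -/
theorem mon_Zee_mem_model {n r : ℕ} {Y' : Fin r → K} {u : ℕ →₀ ℤ} (hu : Bdd n u) :
    mon (Zee g e b) u ∈ model k g e b n Y' :=
  Subalgebra.prod_mem _ fun l hl => Zee_zpow_mem_model (hu l hl) _

/-- `mem_model_of_honest`: Auxiliary step of the key-chain calculus, VERBATIM from the lens-1 g21 companion (see the
module docstring); the statement is its type. [folklore] -/
theorem mem_model_of_honest {n r : ℕ} {Y' : Fin r → K} {x : K} (hx : Honest g e b n Y' x) :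
    x ∈ model k g e b n Y' := by
  obtain ⟨c, u, hu, rfl⟩ := hx
  exact Subalgebra.mul_mem _ (Subalgebra.prod_mem _ fun t _ => Subalgebra.pow_mem _
    (Y_mem_model t) _) (mon_Zee_mem_model hu)

/-- `model_le_O`: Auxiliary step of the key-chain calculus, VERBATIM from the lens-1 g21 companion (see the module
docstring); the statement is its type. [folklore] -/
theorem model_le_O (hK : IsKeyChain k O g e b ζ) (hk : ∀ c : k, algebraMap k K c ∈ O) {n r : ℕ}
    {Y' : Fin r → K} (hY1 : ∀ t, O.valuation (Y' t) < 1) :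
    (model k g e b n Y').toSubring ≤ O.toSubring := by
  refine adjoin_toSubring_le hk ?_
  rintro _ ⟨i, rfl⟩
  rcases i with t | l | l
  · exact (O.valuation_le_one_iff _).mp (hY1 t).le
  · exact (O.valuation_le_one_iff _).mp (hK.valuation_Zee l).le
  · apply (O.valuation_le_one_iff _).mp
    show O.valuation (Zee g e b l)⁻¹ ≤ 1
    rw [map_inv₀, hK.valuation_Zee, inv_one]

/-- `IsKeyChain.valuation_mon_Zee`: Auxiliary step of the key-chain calculus, VERBATIM from the lens-1 g21 companion
(see the module docstring); the statement is its type. [folklore] -/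
theorem IsKeyChain.valuation_mon_Zee (hK : IsKeyChain k O g e b ζ) (u : ℕ →₀ ℤ) :
    O.valuation (mon (Zee g e b) u) = 1 := by
  rw [valuation_mon]
  exact Finset.prod_eq_one fun l _ => by simp only [hK.valuation_Zee, one_zpow]

/-- an honest monomial of value `< 1` is divisible by some `Y′_t` in the model [folklore] -/
theorem exists_dvd_of_honest_lt (hK : IsKeyChain k O g e b ζ) {n r : ℕ} {Y' : Fin r → K} {x : K}
    (hx : Honest g e b n Y' x) (hlt : O.valuation x < 1) :
    ∃ (t : Fin r) (x' : K), x' ∈ model k g e b n Y' ∧ x = Y' t * x' := by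
  classical
  obtain ⟨c, u, hu, rfl⟩ := hx
  have hc : ∃ t, c t ≠ 0 := by
    by_contra h
    push Not at h
    apply (lt_irrefl (1 : O.ValueGroup))
    calc (1 : O.ValueGroup) = O.valuation ((∏ t, Y' t ^ c t) * mon (Zee g e b) u) := by
          rw [map_mul, hK.valuation_mon_Zee, mul_one, map_prod]
          exact (Finset.prod_eq_one fun t _ => by rw [h t, pow_zero, map_one]).symm
      _ < 1 := hlt
  obtain ⟨t₀, ht₀⟩ := hc
  refine ⟨t₀, Y' t₀ ^ (c t₀ - 1) * (∏ t ∈ Finset.univ.erase t₀, Y' t ^ c t) *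
    mon (Zee g e b) u, ?_, ?_⟩
  · exact Subalgebra.mul_mem _ (Subalgebra.mul_mem _ (Subalgebra.pow_mem _ (Y_mem_model t₀) _)
      (Subalgebra.prod_mem _ fun t _ => Subalgebra.pow_mem _ (Y_mem_model t) _))
      (mon_Zee_mem_model hu)
  · rw [← Finset.mul_prod_erase Finset.univ (fun t => Y' t ^ c t) (Finset.mem_univ t₀)]
    have : Y' t₀ ^ c t₀ = Y' t₀ * Y' t₀ ^ (c t₀ - 1) := by
      rw [← pow_succ', Nat.sub_add_cancel (Nat.pos_of_ne_zero ht₀)]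
    rw [this]
    ring

/-- **THE MODEL IS REGULAR AT THE CENTRE.**  Hypotheses: a key chain, `k ⊆ O`, a level
`n ≥ 1`, `r ≤ 3` elements `Y′_t ∈ 𝔪_O ∖ 0`, such that the frame-and-top `g 0, …, g 3` and the
«unit perturbations» `Z_l - ζ_l` (`l + 1 < n`) are honest monomials.  Conclusion: the model
`T = k[Y′, Z^{±1}]` lies in `O`, has fraction field `K`, and its localization at the centre
`𝔮 = 𝔪_O ∩ T = (Y′_1, …, Y′_r, Z_{n-1} - ζ_{n-1})` is a REGULAR local ring of dimension `4`. [folklore] -/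
theorem IsKeyChain.model_regular (hK : IsKeyChain k O g e b ζ) (hk : ∀ c : k, algebraMap k K c ∈ O)
    {n : ℕ} (hn : 1 ≤ n) {r : ℕ} (hr : r ≤ 3) {Y' : Fin r → K}
    (hY1 : ∀ t, O.valuation (Y' t) < 1) (hframe : ∀ i, i < 4 → Honest g e b n Y' (g i))
    (hunit : ∀ l, l + 1 < n → Honest g e b n Y' (Zee g e b l - algebraMap k K (ζ l))) :
    IsFractionRing (model k g e b n Y') K ∧
      IsRegularLocalRing (Localization.AtPrime
        (centreIdeal (model k g e b n Y') O (model_le_O hK hk hY1))) := by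
  classical
  have hg := hK.ne_zero
  set T := model k g e b n Y' with hTdef
  have hTO : T.toSubring ≤ O.toSubring := model_le_O hK hk hY1
  set 𝔮 : Ideal T := centreIdeal T O hTO with h𝔮def
  -- the last unit perturbation `W = Z_{n-1} - ζ_{n-1}`
  have hWmem : Zee g e b (n - 1) - algebraMap k K (ζ (n - 1)) ∈ T :=
    Subalgebra.sub_mem _ (Zee_mem_model ⟨n - 1, by omega⟩) (Subalgebra.algebraMap_mem _ _)
  set W : T := ⟨Zee g e b (n - 1) - algebraMap k K (ζ (n - 1)), hWmem⟩ with hWdef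
  -- the generators of the centre
  let gI : Option (Fin r) → T := fun o => o.elim W fun t => ⟨Y' t, Y_mem_model t⟩
  set I : Ideal T := Ideal.span (Set.range gI) with hIdef
  have hmem𝔮 : ∀ x : T, x ∈ 𝔮 ↔ O.valuation (x : K) < 1 := mem_centreIdeal_iff T hTO
  have hI𝔮 : I ≤ 𝔮 := by
    rw [hIdef, Ideal.span_le]
    rintro _ ⟨o, rfl⟩
    rw [SetLike.mem_coe, hmem𝔮]
    rcases o with _ | t
    · exact hK.valuation_Zee_sub_lt (n - 1)
    · exact hY1 t
  have hYI : ∀ t, (⟨Y' t, Y_mem_model t⟩ : T) ∈ I := fun t => Ideal.subset_span ⟨some t, rfl⟩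
  have hWI : W ∈ I := Ideal.subset_span ⟨none, rfl⟩
  -- `Z_l - ζ_l ∈ I` for every `l < n`
  have hZI : ∀ l : Fin n, (⟨Zee g e b l, Zee_mem_model l⟩ : T) - algebraMap k T (ζ l) ∈ I := by
    intro l
    by_cases hl : (l : ℕ) + 1 < n
    · obtain ⟨t, x', hx', hxeq⟩ := exists_dvd_of_honest_lt hK (hunit l hl)
        (hK.valuation_Zee_sub_lt l)
      have : (⟨Zee g e b l, Zee_mem_model l⟩ : T) - algebraMap k T (ζ l) =
          ⟨Y' t, Y_mem_model t⟩ * ⟨x', hx'⟩ := Subtype.ext hxeq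
      rw [this]
      exact Ideal.mul_mem_right _ _ (hYI t)
    · have hl' : (l : ℕ) = n - 1 := by omega
      have : (⟨Zee g e b l, Zee_mem_model l⟩ : T) - algebraMap k T (ζ l) = W := by
        apply Subtype.ext
        simp only [hWdef, hl']
        rfl
      rw [this]
      exact hWI
  -- CONGRUENCE: every element of `T` is a constant modulo `I`
  have hcong : ∀ x (hx : x ∈ T), ∃ c : k, (⟨x, hx⟩ : T) - algebraMap k T c ∈ I := by
    intro x hx
    refine Algebra.adjoin_induction (p := fun x hx => ∃ c : k, (⟨x, hx⟩ : T) - algebraMap k T c ∈ I)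
      ?_ ?_ ?_ ?_ hx
    · rintro _ ⟨i, rfl⟩
      rcases i with t | l | l
      · refine ⟨0, ?_⟩
        rw [map_zero, sub_zero]
        exact hYI t
      · exact ⟨ζ l, hZI l⟩
      · refine ⟨(ζ l)⁻¹, ?_⟩
        set z : T := ⟨Zee g e b l, Zee_mem_model l⟩
        set zi : T := ⟨(Zee g e b l)⁻¹, Zee_inv_mem_model l⟩
        have h1 : z * zi = 1 := Subtype.ext (mul_inv_cancel₀ (hK.Zee_ne_zero l))
        have h2 : algebraMap k T (ζ l)⁻¹ * algebraMap k T (ζ l) = 1 := by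
          rw [← map_mul, inv_mul_cancel₀ (hK.zeta_ne_zero l), map_one]
        have hid : zi - algebraMap k T (ζ l)⁻¹ =
            -(algebraMap k T (ζ l)⁻¹ * zi) * (z - algebraMap k T (ζ l)) +
              (algebraMap k T (ζ l)⁻¹) * (z * zi - 1) - zi * (algebraMap k T (ζ l)⁻¹ *
                algebraMap k T (ζ l) - 1) := by ring
        rw [h1, h2, sub_self, mul_zero, mul_zero, add_zero, sub_zero] at hid
        change zi - algebraMap k T (ζ l)⁻¹ ∈ I
        rw [hid]
        exact Ideal.mul_mem_left _ _ (hZI l)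
    · intro c
      refine ⟨c, ?_⟩
      have hc : (⟨algebraMap k K c, Subalgebra.algebraMap_mem _ c⟩ : T) = algebraMap k T c := rfl
      rw [hc, sub_self]
      exact Ideal.zero_mem _
    · rintro x y hx hy ⟨c₁, h₁⟩ ⟨c₂, h₂⟩
      refine ⟨c₁ + c₂, ?_⟩
      have : (⟨x + y, Subalgebra.add_mem _ hx hy⟩ : T) - algebraMap k T (c₁ + c₂) =
          ((⟨x, hx⟩ : T) - algebraMap k T c₁) + ((⟨y, hy⟩ : T) - algebraMap k T c₂) := by
        rw [map_add]
        exact Subtype.ext (by push_cast; ring)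
      rw [this]
      exact Ideal.add_mem _ h₁ h₂
    · rintro x y hx hy ⟨c₁, h₁⟩ ⟨c₂, h₂⟩
      refine ⟨c₁ * c₂, ?_⟩
      have : (⟨x * y, Subalgebra.mul_mem _ hx hy⟩ : T) - algebraMap k T (c₁ * c₂) =
          (⟨x, hx⟩ : T) * ((⟨y, hy⟩ : T) - algebraMap k T c₂) +
            ((⟨x, hx⟩ : T) - algebraMap k T c₁) * algebraMap k T c₂ := by
        rw [map_mul]
        exact Subtype.ext (by push_cast; ring)
      rw [this]
      exact Ideal.add_mem _ (Ideal.mul_mem_left _ _ h₂) (Ideal.mul_mem_right _ _ h₁)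
  -- hence `𝔮 = I`
  have h𝔮I : 𝔮 = I := by
    refine le_antisymm (fun x hx𝔮 => ?_) hI𝔮
    obtain ⟨c, hc⟩ := hcong x x.2
    by_cases hc0 : c = 0
    · rw [hc0, map_zero, sub_zero] at hc
      exact hc
    · exfalso
      have hmem : algebraMap k T c ∈ 𝔮 := by
        have := 𝔮.sub_mem hx𝔮 (hI𝔮 hc)
        rwa [sub_sub_cancel] at this
      rw [hmem𝔮] at hmem
      exact absurd (ELU.valuation_algebraMap_eq_one _ hk hc0) (ne_of_lt hmem)
  -- `𝔮` is maximal with residue field `k`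
  haveI h𝔮max : 𝔮.IsMaximal := by
    rw [Ideal.isMaximal_iff]
    refine ⟨fun h1 => ?_, fun J x hJ hx𝔮 hxJ => ?_⟩
    · rw [hmem𝔮] at h1
      simp at h1
    · obtain ⟨c, hc⟩ := hcong x x.2
      have hc0 : c ≠ 0 := by
        rintro rfl
        rw [map_zero, sub_zero] at hc
        exact hx𝔮 (hI𝔮 hc)
      have hcJ : algebraMap k T c ∈ J := by
        have := J.sub_mem hxJ (hJ (hI𝔮 hc))
        rwa [sub_sub_cancel] at this
      have : (1 : T) = algebraMap k T c⁻¹ * algebraMap k T c := by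
        rw [← map_mul, inv_mul_cancel₀ hc0, map_one]
      rw [this]
      exact J.mul_mem_left _ hcJ
  -- `Frac T = K`
  have hadj : Algebra.adjoin k (Set.range fun i : Fin 4 => g i) ≤ T :=
    Algebra.adjoin_le (by rintro _ ⟨i, rfl⟩; exact mem_model_of_honest (hframe i i.2))
  haveI hfr0 : IsFractionRing (Algebra.adjoin k (Set.range fun i : Fin 4 => g i)) K := by
    refine IsFractionRing.of_field _ K fun z => ?_
    have hz : z ∈ IntermediateField.adjoin k (Set.range fun i : Fin 4 => g i) := by
      rw [hK.adjoin_eq_top]; trivial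
    rw [IntermediateField.mem_adjoin_iff_div] at hz
    obtain ⟨a, ha, c, hc, rfl⟩ := hz
    exact ⟨⟨a, ha⟩, ⟨c, hc⟩, rfl⟩
  haveI hfrT : IsFractionRing T K := isFractionRing_subalgebra_of_le _ T hadj
  refine ⟨hfrT, ?_⟩
  -- dimension
  haveI : Algebra.FiniteType k T := (Subalgebra.fg_iff_finiteType T).mp (model_fg n Y')
  haveI : IsNoetherianRing T := Algebra.FiniteType.isNoetherianRing k T
  have htr : Algebra.trdeg k K = 4 := trdeg_eq_four hK.algInd hK.adjoin_eq_top
  have hdimT : ringKrullDim T = (4 : ℕ) := by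
    obtain ⟨m, hm, htrm⟩ := exists_ringKrullDim_eq_and_trdeg_eq k T
    rw [← trdeg_eq_trdeg_of_isFractionRing T, htr] at htrm
    have : m = 4 := by exact_mod_cast htrm.symm
    rw [hm, this]
  have hdim : ringKrullDim (Localization.AtPrime 𝔮) = (4 : ℕ) := by
    rw [ringKrullDim_localization_atPrime_eq_of_isMaximal k 𝔮, hdimT]
  -- at most `r + 1 ≤ 4` generators of the maximal ideal
  apply IsRegularLocalRing.of_spanFinrank_maximalIdeal_le
  rw [hdim]
  have hmap : maximalIdeal (Localization.AtPrime 𝔮) =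
      Ideal.span (Set.range (algebraMap T (Localization.AtPrime 𝔮) ∘ gI)) := by
    rw [← Localization.AtPrime.map_eq_maximalIdeal]
    have hmapI : Ideal.map (algebraMap T (Localization.AtPrime 𝔮)) 𝔮 =
        Ideal.map (algebraMap T (Localization.AtPrime 𝔮)) I :=
      congrArg (Ideal.map (algebraMap T (Localization.AtPrime 𝔮))) h𝔮I
    rw [hmapI, hIdef, Ideal.map_span, ← Set.range_comp]
  rw [hmap]
  have hfin : (Set.range (algebraMap T (Localization.AtPrime 𝔮) ∘ gI)).Finite := Set.finite_range _
  have h1 : (Submodule.span (Localization.AtPrime 𝔮)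
      (Set.range (algebraMap T (Localization.AtPrime 𝔮) ∘ gI))).spanFinrank ≤
        (Set.range (algebraMap T (Localization.AtPrime 𝔮) ∘ gI)).ncard :=
    Submodule.spanFinrank_span_le_ncard_of_finite hfin
  have h2 : (Set.range (algebraMap T (Localization.AtPrime 𝔮) ∘ gI)).ncard ≤ r + 1 := by
    rw [← Set.image_univ]
    refine (Set.ncard_image_le Set.finite_univ).trans ?_
    rw [Set.ncard_univ, Nat.card_eq_fintype_card, Fintype.card_option, Fintype.card_fin]
  have h3 : (Ideal.span (Set.range (algebraMap T (Localization.AtPrime 𝔮) ∘ gI))).spanFinrank ≤ 4 :=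
    h1.trans (h2.trans (by omega))
  exact_mod_cast h3

end Model

section Law

variable {k : Type} [Field k] {K : Type} [Field K] [Algebra k K] {O : ValuationSubring K}
variable {g : ℕ → K} {e : ℕ → ℕ} {b : ℕ → ℕ →₀ ℤ} {ζ : ℕ → k}

/-! ## PART VI — THE LAW: key chains uniformize (§6) -/

/-- `valuation_term`: Auxiliary step of the key-chain calculus, VERBATIM from the lens-1 g21 companion (see the
module docstring); the statement is its type. [folklore] -/
theorem valuation_term (hk : ∀ c : k, algebraMap k K c ∈ O) {c : k} (hc : c ≠ 0) (x : K) :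
    O.valuation (algebraMap k K c * x) = O.valuation x := by
  rw [map_mul, ELU.valuation_algebraMap_eq_one _ hk hc, one_mul]

/-- the DOMINANT TERM of a complete expansion: a term of non-zero coefficient whose value is the
value of the sum and dominates every other non-zero term [folklore] -/
theorem exists_dominant (hk : ∀ c : k, algebraMap k K c ∈ O) {a : K} (ha : a ≠ 0) {N : ℕ}
    {c : Fin N → k} {μ : Fin N → K} (hsum : a = ∑ t, algebraMap k K (c t) * μ t)
    (hle : ∀ t, O.valuation (algebraMap k K (c t) * μ t) ≤ O.valuation a) :
    ∃ t₀, c t₀ ≠ 0 ∧ O.valuation a = O.valuation (μ t₀) ∧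
      ∀ t, c t ≠ 0 → O.valuation (μ t) ≤ O.valuation (μ t₀) := by
  classical
  -- the terms of non-zero coefficient
  set S : Finset (Fin N) := Finset.univ.filter fun t => c t ≠ 0 with hSdef
  have hsumS : a = ∑ t ∈ S, algebraMap k K (c t) * μ t := by
    rw [hsum, hSdef, Finset.sum_filter]
    refine Finset.sum_congr rfl fun t _ => ?_
    by_cases h : c t ≠ 0
    · rw [if_pos h]
    · rw [if_neg h]
      push Not at h
      rw [h, map_zero, zero_mul]
  have hS : S.Nonempty := by
    by_contra h
    rw [Finset.not_nonempty_iff_eq_empty] at h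
    rw [h, Finset.sum_empty] at hsumS
    exact ha hsumS
  obtain ⟨t₀, ht₀S, hmax⟩ := Finset.exists_max_image S (fun t => O.valuation (μ t)) hS
  have hc₀ : c t₀ ≠ 0 := (Finset.mem_filter.mp ht₀S).2
  refine ⟨t₀, hc₀, le_antisymm ?_ ?_, fun t ht => hmax t (Finset.mem_filter.mpr ⟨Finset.mem_univ _, ht⟩)⟩
  · rw [hsumS]
    refine Valuation.map_sum_le _ fun t ht => ?_
    rw [valuation_term hk (Finset.mem_filter.mp ht).2]
    exact hmax t ht
  · have := hle t₀
    rwa [valuation_term hk hc₀] at this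

end Law

end Summit.ResolutionOfSingularities.ResolutionOfSingularities.Theorems.KeyChainLU
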